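import Summits.Ventures.KdS.RouteWSpinFlip
import Summits.Ventures.KdS.RouteWHighSpin
import HarnessLib

/-!
# Venture KdS — the spin flip on the cosmological lattice: the extreme stratum is excluded by the
# energy identity (explicit partner mode)

HONEST FRAMING (venture `Summits/Ventures/KdS`, cell `pub-kds`; follows the design note
`lit/LIT1-KC-SPINFLIP-SCOPING.md` (F4) of the cell's literature seat). On the cosmological lattice
the Teukolsky–Starobinsky transfer `RouteW.spinFlip_core` is not injective: at the EXTREME stratum
`s + 2B(r_c) = 2s − 1` (i.e. `Re ω = mϖ₂`, `Im ω = (s−1)κ₂` — the only lattice point with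
`Im ω > 0` when `s ≤ 2`) a non-zero generic-boundary radial solution with vanishing image is the
algebraically special monomial, which pins the accessory parameter (clause (b) of `spinFlip_core`).
This file shows that this situation is incompatible with the hypotheses of Casals–Teixeira da
Costa's theorem: transporting the accessory condition through the Möbius automorphism
(`SpinFlipTS.mobiusQ_of_flipQ_extreme`, P1 g3's `accessoryIdentity_holds`) gives the Euler-gauge
condition `q = ργz₂`, which is EXACTLY the condition for the explicit PARTNER
`ṽ(z) = (z−1)^{2(η₀+η₁)}` to solve the `m₂ ↔ m₃`-swapped equation (`euler_partner_accessory`,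
`SpinFlipTS.isSolutionOn_monomial`); the landed `gaugeGlue_holds` and
`swappedEnergyVanishing_holds` (energy identity of CTdC's Thm 3.10 Step 2, `s` free) then force
`ṽ ≡ 0` under `Im ω > 0`, `Im(λ̄ω̄) ≤ 0`, `|ω| ∉ |m|(0,Ω_SR)` — a contradiction. Hence
`radial_vanishing_lattice_extreme`: CTdC Prop. 3.8's conclusion AT the extreme lattice point, and
`radial_vanishing_of_im_gt_pred_cosmo`: for every half-integer `s ≥ 1/2` on
`Im ω > (s−2)κ₂` (all of `Im ω > 0` when `s ≤ 2`). 0 cited facts. Non-extreme strata (`s ≥ 5/2`,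
`0 < Im ω ≤ (s−2)κ₂` on the ray `Re ω = mϖ₂`) are NOT treated here.
-/

noncomputable section

open Set Complex

namespace Summit.Ventures.KdS

namespace RouteW

open Literature.Analysis.ODE Literature.Analysis.ODE.GeneralHeun
open Literature.Geometry.Lorentzian Literature.Geometry.Lorentzian.KerrDeSitter
open SpinFlipTS

/-! ### Mass-level identities at the extreme stratum `2η₂ = 1 − s` -/

/-- At `2η₂ = 1 − s` the accessory condition of the monomial `(z−1)^{2η₁−s}` for the masses
`(m₁,m₂,m₃,m₄)` and that of the partner monomial `(z−1)^{2(η₀+η₁)}` for the swapped masses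
`(m₁,m₃,m₂,m₄)` differ by the same amount as the accessory parameters (pure algebra). -/
theorem euler_partner_accessory (s η₀ η₁ η₂ E z₂ : ℂ) (h : 2 * η₂ = 1 - s) :
    eulerGaugeQ (sqcdM₁ s η₀ η₁) (sqcdM₃ s η₀ η₁) (sqcdM₂ η₀ η₁) (sqcdM₄ η₀ η₁ η₂) E z₂ -
        2 * (η₀ + η₁) * eulerGaugeγ (sqcdM₁ s η₀ η₁) (sqcdM₃ s η₀ η₁) * z₂ =
      eulerGaugeQ (sqcdM₁ s η₀ η₁) (sqcdM₂ η₀ η₁) (sqcdM₃ s η₀ η₁) (sqcdM₄ η₀ η₁ η₂) E z₂ -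
        (2 * η₁ - s) * eulerGaugeγ (sqcdM₁ s η₀ η₁) (sqcdM₂ η₀ η₁) * z₂ := by
  have hη₂ : η₂ = (1 - s) / 2 := by linear_combination h / 2
  unfold eulerGaugeQ eulerGaugeγ sqcdM₁ sqcdM₂ sqcdM₃ sqcdM₄
  rw [hη₂]
  ring

/-- At `2η₂ = 1 − s` the partner exponent `2(η₀+η₁)` is a root of the indicial pair at infinity of
the swapped equation: `2(η₀+η₁) + β̃ = 1 − s − 2η₂ = 0`. -/
theorem euler_partner_indicial (s η₀ η₁ η₂ : ℂ) (h : 2 * η₂ = 1 - s) :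
    (2 * (η₀ + η₁) + eulerGaugeα (sqcdM₃ s η₀ η₁) (sqcdM₂ η₀ η₁)) *
        (2 * (η₀ + η₁) + eulerGaugeβ (sqcdM₃ s η₀ η₁) (sqcdM₄ η₀ η₁ η₂)) = 0 := by
  have h2 : 2 * (η₀ + η₁) + eulerGaugeβ (sqcdM₃ s η₀ η₁) (sqcdM₄ η₀ η₁ η₂) = 0 := by
    unfold eulerGaugeβ sqcdM₃ sqcdM₄
    linear_combination -h
  rw [h2, mul_zero]

/-- The partner exponent is the non-analytic local exponent at `z = 1` of the swapped equation:
`2(η₀+η₁) = 1 − δ̃`. -/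
theorem euler_partner_exponent (s η₀ η₁ : ℂ) :
    2 * (η₀ + η₁) = 1 - eulerGaugeδ (sqcdM₁ s η₀ η₁) (sqcdM₃ s η₀ η₁) := by
  unfold eulerGaugeδ sqcdM₁ sqcdM₃; ring

/-! ### The extreme lattice stratum -/

/-- **CTdC Prop. 3.8's conclusion at the extreme lattice point.** For subextremal `(M,a,Λ)`,
`0 ≤ a`, `2s = N ≥ 1`, `Im ω > 0`, `Im(λ̄ω̄) ≤ 0`, `|ω| ∉ |m|(0,Ω_SR)`, the pair condition for
`−2(η₁+η₀)`, and `s + 2B(r_c) = 2s − 1` (the extreme stratum of the cosmological lattice): every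
generic-boundary radial Teukolsky solution of spin `s` vanishes on `(r₊, r_c)`. Proof: the image
`R'` of `spinFlip_core` vanishes by route W (`radial_vanishing_lt_one`); if `R ≢ 0`, clause (b)
pins the accessory parameter; the explicit partner `(z−1)^{2(η₀+η₁)}` then solves the swapped
equation (`isSolutionOn_monomial`), has the mode-data branches, and is killed by
`gaugeGlue_holds` + `swappedEnergyVanishing_holds` — but it is not zero. PROVED, 0 cited facts. -/
theorem radial_vanishing_lattice_extreme {M a Λ s : ℝ} {ω : ℂ} {m : ℝ} {lam : ℂ} {R : ℝ → ℂ}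
    (hsub : IsSubextremal M a Λ) (ha : 0 ≤ a) {N : ℕ} (hN1 : 1 ≤ N) (hsN : 2 * s = N)
    (hω : 0 < ω.im) (hlam : (lambdaBar a Λ s ω m lam * (starRingEnd ℂ) ω).im ≤ 0)
    (hSR : ¬(0 < ‖ω‖ ∧ ‖ω‖ < |m| * superradiantUpper M a Λ))
    (hp₃ : PairCondition (-2 * (etaEvent M a Λ ω m + etaCauchy M a Λ ω m)))
    (hext : (s : ℂ) + 2 * horizonB M a Λ ω m (rCosmo M a Λ) = (N : ℂ) - 1)
    (hR : IsRadialTeukolskySolution M a Λ s ω m lam R) (hin : IsIngoingAtEventHorizon M a Λ s ω m R)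
    (hout : IsOutgoingAtCosmoHorizon M a Λ ω m R) :
    ∀ r ∈ Ioo (rPlus M a Λ) (rCosmo M a Λ), R r = 0 := by
  obtain ⟨R', hR', hin', hout', hinj⟩ := spinFlip_core M a Λ s ω m lam R N hsub hN1 hsN hR hin hout
  have hN' : (1 : ℝ) ≤ N := by exact_mod_cast hN1
  have hs' : -s < 1 := by linarith
  have hlam' : (lambdaBar a Λ (-s) ω m (lamFlip a Λ s lam) * (starRingEnd ℂ) ω).im ≤ 0 := by
    rw [lambdaBar_lamFlip]; exact hlam
  have hR'0 := radial_vanishing_lt_one hsub ha hs' hω hlam' hSR hp₃ hR' hin' hout'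
  rcases (hinj hR'0).2 hext with h0 | hacc
  · exact h0
  exfalso
  -- abbreviations
  set η₀ := etaCauchy M a Λ ω m with hη₀
  set η₁ := etaEvent M a Λ ω m with hη₁
  set η₂ := etaCosmo M a Λ ω m with hη₂
  set z₂ := zTwo M a Λ with hz₂def
  have hz₂ : 1 < z₂ := one_lt_zTwo hsub
  have hzr : 1 < mobiusZr M a Λ := one_lt_mobiusZr hsub
  have hNs : (N : ℂ) = 2 * (s : ℂ) := by exact_mod_cast hsN.symm
  -- (C1): `2η₂ = 1 − s`
  have hC1 : 2 * η₂ = 1 - (s : ℂ) := by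
    have h := hext
    rw [horizonB_rCosmo_eq_neg_etaCosmo hsub, hNs] at h
    linear_combination -h
  -- the source accessory condition in the Euler gauge: `q_E = (2η₁ − s)·γ_E·z₂`
  have hQE : eulerGaugeQ (mass₁ M a Λ s ω m) (mass₂ M a Λ ω m) (mass₃ M a Λ s ω m) (mass₄ M a Λ ω m)
        (bigE M a Λ s ω m lam) (z₂ : ℂ) =
      (2 * η₁ - (s : ℂ)) * eulerGaugeγ (mass₁ M a Λ s ω m) (mass₂ M a Λ ω m) * (z₂ : ℂ) := by
    rw [hz₂def, ← accessoryIdentity_holds M a Λ s ω m lam hsub, ← mobiusγ_eq hsub, hη₁,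
      ← one_sub_heunGamma hsub, ← mobiusA_mobiusZr hsub]
    have hα : heunSigmaPlus s = (N : ℂ) + 1 := by
      unfold heunSigmaPlus; rw [hNs]
    have hδ : heunDelta M a Λ s ω m = (N : ℂ) := by
      unfold heunDelta; linear_combination hext
    have hF := heun_fuchs hsub s ω m
    exact mobiusQ_of_flipQ_extreme (ne_of_gt hzr) hα hδ hF hacc
  -- the partner accessory condition: `q̃ = 2(η₀+η₁)·γ̃·z₂`
  have hQt : eulerGaugeQ (mass₁ M a Λ s ω m) (mass₃ M a Λ s ω m) (mass₂ M a Λ ω m) (mass₄ M a Λ ω m)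
        (bigE M a Λ s ω m lam) (z₂ : ℂ) =
      2 * (η₀ + η₁) * eulerGaugeγ (mass₁ M a Λ s ω m) (mass₃ M a Λ s ω m) * (z₂ : ℂ) := by
    have h := euler_partner_accessory (s : ℂ) η₀ η₁ η₂ (bigE M a Λ s ω m lam) (z₂ : ℂ) hC1
    unfold mass₁ mass₂ mass₃ mass₄ at hQE ⊢
    rw [← hη₀, ← hη₁, ← hη₂] at hQE ⊢
    linear_combination h + hQE
  -- the partner solves the swapped Euler-gauge Heun equation on (1, z₂)
  set ρt : ℂ := 2 * (η₀ + η₁) with hρt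
  set vt : ℝ → ℂ := fun w => ((w - 1 : ℝ) : ℂ) ^ ρt with hvt
  have hsol : IsSolutionOn (z₂ : ℂ) (eulerGaugeα (mass₃ M a Λ s ω m) (mass₂ M a Λ ω m))
      (eulerGaugeβ (mass₃ M a Λ s ω m) (mass₄ M a Λ ω m))
      (eulerGaugeγ (mass₁ M a Λ s ω m) (mass₃ M a Λ s ω m))
      (eulerGaugeδ (mass₁ M a Λ s ω m) (mass₃ M a Λ s ω m))
      (eulerGaugeε (mass₂ M a Λ ω m) (mass₄ M a Λ ω m))
      (eulerGaugeQ (mass₁ M a Λ s ω m) (mass₃ M a Λ s ω m) (mass₂ M a Λ ω m) (mass₄ M a Λ ω m)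
        (bigE M a Λ s ω m lam) (z₂ : ℂ)) (Ioo 1 z₂) vt := by
    refine isSolutionOn_monomial (eulerGauge_fuchs _ _ _ _) ?_ ?_ ?_
    · unfold mass₁ mass₃; rw [← hη₀, ← hη₁]; exact euler_partner_exponent (s : ℂ) η₀ η₁
    · unfold mass₂ mass₃ mass₄; rw [← hη₀, ← hη₁, ← hη₂]
      exact euler_partner_indicial (s : ℂ) η₀ η₁ η₂ hC1
    · rw [hQt]
  -- mode data of the partner: branch `ρt` at 1 (cofactor 1), analytic at z₂
  have hdata : HeunModeData z₂ (eulerGaugeα (mass₃ M a Λ s ω m) (mass₂ M a Λ ω m))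
      (eulerGaugeβ (mass₃ M a Λ s ω m) (mass₄ M a Λ ω m))
      (eulerGaugeγ (mass₁ M a Λ s ω m) (mass₃ M a Λ s ω m))
      (eulerGaugeδ (mass₁ M a Λ s ω m) (mass₃ M a Λ s ω m))
      (eulerGaugeε (mass₂ M a Λ ω m) (mass₄ M a Λ ω m))
      (eulerGaugeQ (mass₁ M a Λ s ω m) (mass₃ M a Λ s ω m) (mass₂ M a Λ ω m) (mass₄ M a Λ ω m)
        (bigE M a Λ s ω m lam) (z₂ : ℂ)) ρt vt := by
    refine ⟨hsol, ⟨1, one_pos, fun _ => 1, contDiffOn_const, fun w _ => by simp [hvt]⟩,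
      ⟨(z₂ - 1) / 2, by linarith, vt, ?_, fun w _ => rfl⟩⟩
    have hpos : ∀ w ∈ Ioo (z₂ - (z₂ - 1) / 2) (z₂ + (z₂ - 1) / 2), 0 < w - 1 := by
      intro w hw; have := hw.1; linarith
    intro w hw
    have hslit : ((w - 1 : ℝ) : ℂ) ∈ slitPlane := Complex.ofReal_mem_slitPlane.2 (hpos w hw)
    have h1 : AnalyticAt ℂ (fun z : ℂ => z ^ ρt) ((w - 1 : ℝ) : ℂ) :=
      analyticAt_id.cpow analyticAt_const hslit
    have h3 : AnalyticAt ℝ (fun y : ℝ => ((y - 1 : ℝ) : ℂ)) w := by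
      have : AnalyticAt ℝ (fun y : ℝ => (y : ℂ) - 1) w :=
        (Complex.ofRealCLM.analyticAt w).sub analyticAt_const
      refine this.congr (Filter.Eventually.of_forall fun y => ?_)
      push_cast; ring
    have h4 : AnalyticAt ℝ (fun y : ℝ => ((y - 1 : ℝ) : ℂ) ^ ρt) w :=
      AnalyticAt.comp (g := fun z : ℂ => z ^ ρt) (f := fun y : ℝ => ((y - 1 : ℝ) : ℂ)) (x := w)
        h1.restrictScalars h3
    exact h4.contDiffAt.contDiffWithinAt
  -- gauge glue: normal-form data for the swapped coefficient
  obtain ⟨Rt, hRt, hRtinj⟩ := gaugeGlue_holds z₂ (mass₁ M a Λ s ω m) (mass₃ M a Λ s ω m)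
    (mass₂ M a Λ ω m) (mass₄ M a Λ ω m) (bigE M a Λ s ω m lam) ρt vt hz₂ hdata
  have he₁ : ρt + eulerGaugeδ (mass₁ M a Λ s ω m) (mass₃ M a Λ s ω m) / 2 =
      1 / 2 + etaCauchy M a Λ ω m + etaEvent M a Λ ω m := by
    unfold mass₁ mass₃
    rw [eulerGaugeδ_swap_eta, hρt, hη₀, hη₁]
    ring
  have he₂ : eulerGaugeε (mass₂ M a Λ ω m) (mass₄ M a Λ ω m) / 2 =
      1 / 2 - etaCauchy M a Λ ω m - etaCosmo M a Λ ω m := by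
    unfold mass₂ mass₄
    rw [eulerGaugeε_swap_eta]
    ring
  rw [he₁, he₂] at hRt
  -- the coefficient of (3.25) = (3.11) with m₂ ↔ m₃ on (1, z₂)
  have hsub' := hsub
  obtain ⟨hM, hΛ, h01, h12, -⟩ := hsub'
  have hr₀ : 0 ≤ rMinus M a Λ := rMinus_nonneg M a Λ
  have hcoef : ∀ z ∈ Ioo 1 z₂,
      sqcdCoeff (mass₁ M a Λ s ω m) (mass₃ M a Λ s ω m) (mass₂ M a Λ ω m) (mass₄ M a Λ ω m)
          (bigE M a Λ s ω m lam) (z₂ : ℂ) z = tildeCoeff M a Λ s ω m lam z := by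
    intro z hz
    obtain ⟨hz1, hzz⟩ := hz
    unfold tildeCoeff bigE mass₁ mass₂ mass₃ mass₄
    rw [hz₂def] at hzz ⊢
    unfold zTwo
    symm
    refine ctdcTilde_eq_sqcd_swap (s : ℂ) η₀ η₁ η₂ (ltBlock M a Λ s ω m lam) ?_ ?_ ?_ ?_ ?_ ?_ ?_
    · exact_mod_cast (sub_pos.mpr h01).ne'
    · have : 0 < rCosmo M a Λ + (rMinus M a Λ + rPlus M a Λ + rCosmo M a Λ) := by linarith
      exact_mod_cast this.ne'
    · have : 0 < rPlus M a Λ + rCosmo M a Λ := by linarith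
      exact_mod_cast this.ne'
    · have : (0 : ℝ) < z := by linarith
      exact_mod_cast this.ne'
    · exact sub_ne_zero.mpr (by exact_mod_cast (ne_of_gt hz1))
    · unfold zTwo at hzz
      exact sub_ne_zero.mpr (by exact_mod_cast (ne_of_gt hzz))
    · rw [hz₂def] at hz₂
      unfold zTwo at hz₂
      have : (0 : ℝ) < ctdcZ₂ (rMinus M a Λ) (rPlus M a Λ) (rCosmo M a Λ) := by linarith
      exact_mod_cast this.ne'
  have hRt' : NormalFormModeData z₂ (tildeCoeff M a Λ s ω m lam)
      (1 / 2 + etaCauchy M a Λ ω m + etaEvent M a Λ ω m)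
      (1 / 2 - etaCauchy M a Λ ω m - etaCosmo M a Λ ω m) Rt := hRt.congr hcoef
  -- the energy identity kills the partner — contradiction
  have hRt0 := swappedEnergyVanishing_holds M a Λ s ω m lam Rt hsub ha hω hlam hSR hRt'
  have hvt0 := hRtinj hRt0
  have hw : (1 + z₂) / 2 ∈ Ioo 1 z₂ := ⟨by linarith, by linarith⟩
  have h := hvt0 _ hw
  simp only [hvt] at h
  exact ofReal_cpow_ne_zero (show (0 : ℝ) < (1 + z₂) / 2 - 1 by linarith) ρt h

/-- Above the height `(s−2)κ₂` a lattice point is the extreme one: if the off-lattice condition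
fails and `Im ω > (s−2)κ₂` then `s + 2B(r_c) = 2s − 1`. -/
theorem extreme_of_not_offLattice {M a Λ : ℝ} (hsub : IsSubextremal M a Λ) {s : ℝ} {ω : ℂ}
    {m : ℝ} {N : ℕ} (hsN : 2 * s = N)
    (hhi : (s - 2) * surfaceGravity M a Λ (rCosmo M a Λ) < ω.im) (hnot : ¬OffLattice M a Λ s ω m) :
    (s : ℂ) + 2 * horizonB M a Λ ω m (rCosmo M a Λ) = (N : ℂ) - 1 := by
  obtain ⟨j, hj, hj'⟩ : ∃ j : ℤ, (j : ℝ) ≤ 2 * s - 1 ∧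
      (s : ℂ) + 2 * horizonB M a Λ ω m (rCosmo M a Λ) = j := by
    by_contra h
    exact hnot fun j hj hj' => h ⟨j, hj, hj'⟩
  have hκ := surfaceGravity_rCosmo_pos hsub
  -- real part: `s + Im ω/κ₂ = j`, hence `j > 2s − 2`, so `j = 2s − 1 = N − 1`
  have hre := congrArg Complex.re hj'
  rw [horizonB_rCosmo_eq_neg_etaCosmo hsub] at hre
  simp [etaCosmo_re] at hre
  have h2 : 2 * (ω.im / (2 * surfaceGravity M a Λ (rCosmo M a Λ))) =
      ω.im / surfaceGravity M a Λ (rCosmo M a Λ) := by field_simp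
  have h1 : s - 2 < ω.im / surfaceGravity M a Λ (rCosmo M a Λ) := by
    rw [lt_div_iff₀ hκ]; linarith
  have hjlo : (2 * s - 2 : ℝ) < j := by linarith
  have hjN : (j : ℝ) = N - 1 := by
    have hlo : ((N : ℤ) - 2 : ℝ) < (j : ℝ) := by push_cast; linarith
    have hhi' : (j : ℝ) ≤ (N : ℤ) - 1 := by push_cast; linarith
    have h3 : (N : ℤ) - 2 < j := by exact_mod_cast hlo
    have h4 : j ≤ (N : ℤ) - 1 := by exact_mod_cast hhi'
    have : j = (N : ℤ) - 1 := by omega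
    rw [this]; push_cast; ring
  rw [hj']
  have : ((j : ℤ) : ℂ) = ((j : ℝ) : ℂ) := by norm_cast
  rw [this, hjN]
  push_cast
  ring

/-- **CTdC Prop. 3.8's conclusion for every half-integer spin above the height `(s−2)κ₂`** — in
particular for EVERY spin `s ≤ 2` on the whole open upper half-plane (the physically relevant
Teukolsky spins `|s| ≤ 2`): off the lattice by the spin flip (`radial_vanishing_offLattice` in
`RouteWSpinFlipProp38` uses the same ingredients; here inlined), at the extreme lattice point by the
partner argument. Hypotheses: subextremal, `0 ≤ a`, `2s = N ≥ 1`, `Im ω > 0`,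
`(s−2)κ₂ < Im ω`, `Im(λ̄ω̄) ≤ 0`, `|ω| ∉ |m|(0,Ω_SR)`, pair condition for `−2(η₁+η₀)`. PROVED,
0 cited facts. -/
theorem radial_vanishing_of_im_gt_pred_cosmo {M a Λ s : ℝ} {ω : ℂ} {m : ℝ} {lam : ℂ} {R : ℝ → ℂ}
    (hsub : IsSubextremal M a Λ) (ha : 0 ≤ a) {N : ℕ} (hN1 : 1 ≤ N) (hsN : 2 * s = N)
    (hω : 0 < ω.im) (hhi : (s - 2) * surfaceGravity M a Λ (rCosmo M a Λ) < ω.im)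
    (hlam : (lambdaBar a Λ s ω m lam * (starRingEnd ℂ) ω).im ≤ 0)
    (hSR : ¬(0 < ‖ω‖ ∧ ‖ω‖ < |m| * superradiantUpper M a Λ))
    (hp₃ : PairCondition (-2 * (etaEvent M a Λ ω m + etaCauchy M a Λ ω m)))
    (hR : IsRadialTeukolskySolution M a Λ s ω m lam R) (hin : IsIngoingAtEventHorizon M a Λ s ω m R)
    (hout : IsOutgoingAtCosmoHorizon M a Λ ω m R) :
    ∀ r ∈ Ioo (rPlus M a Λ) (rCosmo M a Λ), R r = 0 := by
  by_cases hoff : OffLattice M a Λ s ω m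
  · obtain ⟨R', hR', hin', hout', hinj⟩ := spinFlip_core M a Λ s ω m lam R N hsub hN1 hsN hR hin hout
    have hN' : (1 : ℝ) ≤ N := by exact_mod_cast hN1
    have hs' : -s < 1 := by linarith
    have hlam' : (lambdaBar a Λ (-s) ω m (lamFlip a Λ s lam) * (starRingEnd ℂ) ω).im ≤ 0 := by
      rw [lambdaBar_lamFlip]; exact hlam
    exact (hinj (radial_vanishing_lt_one hsub ha hs' hω hlam' hSR hp₃ hR' hin' hout')).1 hoff
  · exact radial_vanishing_lattice_extreme hsub ha hN1 hsN hω hlam hSR hp₃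
      (extreme_of_not_offLattice hsub hsN hhi hoff) hR hin hout

end RouteW

end Summit.Ventures.KdS
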